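import Literature.AlgebraicGeometry.HodgeTheory.BettiUniverseKunnethHodgePowersNormalForm
import Literature.AlgebraicGeometry.HodgeTheory.HypersurfaceLefschetz
import Literature.AlgebraicGeometry.HodgeTheory.BettiNumbersEulerCharacteristic
import Literature.AlgebraicGeometry.HodgeTheory.ComplexConjugationHolds
import Literature.AlgebraicGeometry.Motives.HodgeTensorFactsHolds
import Summits.HodgeConjecture.HodgeConjecture.Theorems.BoundaryReadoutPullbackAlgebraic
import HarnessLib

/-!
# K2Q brick KS-Q (route `Q8SymplecticPowers`, item stmt-HodgeConjecture-24191 `PowersHodgeOfQuaternionCommutators`) —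
# the Künneth–Hodge normal form per tensor summand of `H^{2q}(X^{k+1})`, for EVERY smooth projective surface with `b₁ = 0`

Cell `hodge-nonav`, prover seat `hodge-nonav-20241-p1` (g20); programme K2Q (STATUS 2026-08-29T07:28:46Z), first brick.
HELPER FILE (`--supports stmt-HodgeConjecture-24191 --as helper`; it does not prove a registered stub and closes nothing).
Sorry-free; axioms standard.

The crux K2Q binds a smooth projective SURFACE `X` with `dim_ℚ H¹(X(ℂ); ℚ) = 0` (and a cohomological quaternion deck pair,
not used here). This file is the twin of route A's K2 stub KS `CyclicUnitaryPowersSummandHodgeNormalFormSurface`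
(`stub_summandHodgeNormalFormSurface`, smooth `p`-cyclic surfaces `x₃^p = f` in `ℙ³`) with the hypersurface hypothesis
REPLACED by `b₁(X) = 0`: the generic normal form `BettiUniverse.fanKunnethMap_powInsert_mem_span_normalForm`
(`BettiUniverseKunnethHodgePowersNormalForm`: Voisin I Thm. 11.40 ∕ Lemma 11.41 with Deligne's Tate-type factors) at
`n = 2` needs only (i) `Hʲ(X) = 0` for odd `j ≠ 2` — `H¹ = 0` is the hypothesis, `H³ = 0` by Poincaré symmetry
`b₃ = b₁` (`BettiUniverse.finrank_bettiCohomology_eq_of_add_eq`), `Hʲ = 0` for `j ≥ 5` above the top degree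
(`ComplexPoints.subsingleton_singularCohomology_of_lt`); (ii) `H⁰` and `H^{2a}`, `a ≥ 2`, entirely algebraic
(`algebraicClasses_eq_top_of_eq_zero_or_le`: fundamental class, point class, vanishing) — both true for ANY smooth
projective surface; and (iii) Fulton's pull-back fact, a tree THEOREM (`fulton1998_map_mem_algebraicClasses_holds`).

* `summandHodgeNormalForm_of_fulton` — the conclusion of route A's KS VERBATIM (span of decorated Künneth insertions
  `E t` of Hodge tensors `t ∈ T^{r,0} H²(X)`) for `X` smooth projective with `b₁ = 0`, Fulton's fact as a hypothesis;
* `summandHodgeNormalForm` — the same with Fulton's fact DISCHARGED.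

Next bricks of K2Q (programme line): C-Q (Hodge tensors are fixed by the commutators of the typed quaternionic
centraliser; in degree 2 the engine `Q8CommutatorDegreeTwoCore.q8Commutator_invariant_bilinForm_eq`), A-Q (the four
pairing classes `tr(x ∪ g^*y)`, `g ∈ {1, τ, j, τj}`, are algebraic Künneth components of graph classes), F-Q (FFT port:
invariants of `1 ⊗ Sp(M)` on `(S ⊗ M)^{⊗N}`). Honest scope: bookkeeping; nothing here says HC, HC_CM or HC_AV is proved.

References: C. Voisin, *Hodge Theory I* (2002), Thm. 11.40, Lemma 11.41, §11.3.3; P. Deligne, Hodge cycles on abelian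
varieties (1982), §1; W. Fulton, *Intersection Theory* (1998), Cor. 19.2.
-/

set_option linter.dupNamespace false

noncomputable section

namespace Summit.HodgeConjecture.HodgeConjecture.Theorems.Q8SymplecticPowersSummandHodgeNormalForm

open Literature.AlgebraicGeometry.Motives Literature.AlgebraicGeometry.HodgeTheory
open Literature.AlgebraicGeometry.HodgeTheory.BettiUniverse
open Literature.AlgebraicTopology.SingularHomology
open CategoryTheory CategoryTheory.Limits

/-- The odd Betti cohomology of a smooth projective surface with `b₁ = 0` vanishes off the middle degree:
`H¹ = 0` (hypothesis), `H³ = 0` (Poincaré symmetry), `Hʲ = 0` for `j ≥ 5` (above the top degree).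
[cite: VoisinHodgeI2002, §11.3.3 Lemma 11.41] -/
theorem subsingleton_bettiCohomology_of_odd_of_b₁ {X : SchemeOver ℂ} (hX : IsSmoothProjective 2 X)
    (hb1 : Module.finrank ℚ (bettiCohomology X 1) = 0) {j : ℕ} (hj : Odd j) (hj2 : j ≠ 2) :
    Subsingleton (bettiCohomology X j) := by
  haveI := BettiUniverse.finite hX 1
  haveI := BettiUniverse.finite hX 3
  rcases Nat.lt_or_ge j 5 with hlt | hge
  · -- `j ∈ {1, 3}`
    obtain ⟨m, rfl⟩ := hj
    have hm : m = 0 ∨ m = 1 := by omega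
    rcases hm with rfl | rfl
    · exact Module.finrank_zero_iff.1 hb1
    · have h3 : Module.finrank ℚ (bettiCohomology X 3) = 0 := by
        rw [BettiUniverse.finrank_bettiCohomology_eq_of_add_eq hX (k := 3) (l := 1) (by norm_num)]
        exact hb1
      exact Module.finrank_zero_iff.1 h3
  · exact ComplexPoints.subsingleton_singularCohomology_of_lt hX ℚ (k := j) (by omega)

/-- **K2Q brick KS-Q, Fulton's fact as a hypothesis**: for a smooth projective surface `X` with `b₁(X) = 0`, a limit
fan `Fan.mk Y π` on `k + 1` copies of `X` and a Hodge class `x` (type `(q, q)`) of ONE tensor summand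
`PowSummand X k κ`, the class `fanKunnethMap π hlim (2q) (powInsert X k κ x)` lies in the `ℚ`-span of the classes
`E t` — `E` a Künneth insertion of covariant tensors of `H²(X)` decorated by a class with algebraic complexification,
`t` a Hodge tensor of `T^{r,0} H²(X)` (conclusion VERBATIM that of route A's `stub_summandHodgeNormalFormSurface`).
[cite: VoisinHodgeI2002, Thm. 11.40 and Lemma 11.41] [cite: Fulton1998, Cor. 19.2] -/
theorem summandHodgeNormalForm_of_fulton :
    open Literature.AlgebraicGeometry.Motives Literature.AlgebraicGeometry.HodgeTheory Literature.AlgebraicGeometry.HodgeTheory.BettiUniverse CategoryTheory.Limits in Literature.AlgebraicGeometry.HodgeTheory.fulton1998_map_mem_algebraicClasses → ∀ ⦃X : SchemeOver ℂ⦄ (hX : IsSmoothProjective 2 X), Module.finrank ℚ (bettiCohomology X 1) = 0 → ∀ [Module.Finite ℚ (bettiCohomology X 2)] [HodgeTensorFacts.{0, 0}] ⦃k : ℕ⦄ ⦃Y : SchemeOver ℂ⦄ (π : Fin (k + 1) → (Y ⟶ X)) (hlim : IsLimit (Fan.mk Y π)) (q : ℕ) (κ : PowIdx k (2 * q)) (x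 : PowSummand X k κ), x ∈ (powSummandHodge exists_isReal_hodgeModel_holds hX k κ).hodgeClasses (q : ℤ) → fanKunnethMap π hlim (2 * q) (powInsert X k κ x) ∈ Submodule.span ℚ {x : bettiCohomology Y (2 * q) | ∃ (q' r : ℕ) (u : Fin r → Fin (k + 1)) (wdec : bettiCohomology Y (2 * q')) (_ : ofRatClass (ComplexPoints Y) (2 * q') wdec ∈ algebraicClasses Y q') (E : hodgeTensorSpace (bettiCohomology X 2) r 0 →ₗ[ℚ] bettiCohomology Y (2 * q)) (_ : (∀ w : Fin r → Fin (Module.finrank ℚ (bettiCohomology X 2)), (⟨2 * q, E ((PiTensorProduct.tprod ℚ fun i => (Module.finBasis ℚ (bettiCohomology X 2)) (w i)) ⊗ₜ[ℚ] (PiTensorProduct.tprod ℚ fun i : Fin 0 => (Fin.elim0 i : Module.Dual ℚ (bettiCohomology X 2))))⟩ : Σ n, bettiCohomology Y n) = List.foldl (fun (acc : Σ n, bettiCohomology Y n) (i : Fin r) => ⟨acc.1 + 2, cup Y acc.1 2 acc.2 (pull (π (u i)) 2 ((Module.finBasis ℚ (bettiCohomology X 2)) (w i)))⟩) ⟨2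 * q', wdec⟩ (List.finRange r))) (t : hodgeTensorSpace (bettiCohomology X 2) r 0) (_ : (∃ p' : ℤ, ((r : ℤ) - ((0 : ℕ) : ℤ)) * ((2 : ℕ) : ℤ) = 2 * p' ∧ t ∈ ((hodge exists_isReal_hodgeModel_holds hX 2).tensorSpace r 0).hodgeClasses p')), x = E t} := by
  intro hP X hX hb1 _ _ k Y π hlim q κ x hx
  exact fanKunnethMap_powInsert_mem_span_normalForm exists_isReal_hodgeModel_holds hX hP
    (fun j hj hjn ↦ subsingleton_bettiCohomology_of_odd_of_b₁ hX hb1 hj hjn)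
    (fun a ha ↦ algebraicClasses_eq_top_of_eq_zero_or_le hX (by omega)) π hlim q κ x hx

/-- **K2Q brick KS-Q, unconditional**: `summandHodgeNormalForm_of_fulton` with Fulton's pull-back fact DISCHARGED by the
tree theorem `fulton1998_map_mem_algebraicClasses_holds`. [cite: VoisinHodgeI2002, Thm. 11.40 and Lemma 11.41]
[cite: Fulton1998, Cor. 19.2] -/
theorem summandHodgeNormalForm :
    open Literature.AlgebraicGeometry.Motives Literature.AlgebraicGeometry.HodgeTheory Literature.AlgebraicGeometry.HodgeTheory.BettiUniverse CategoryTheory.Limits in ∀ ⦃X : SchemeOver ℂ⦄ (hX : IsSmoothProjective 2 X), Module.finrank ℚ (bettiCohomology X 1) = 0 → ∀ [Module.Finite ℚ (bettiCohomology X 2)] [HodgeTensorFacts.{0, 0}] ⦃k : ℕ⦄ ⦃Y : SchemeOver ℂ⦄ (π : Fin (k + 1) → (Y ⟶ X)) (hlim : IsLimit (Fan.mk Y π)) (q : ℕ) (κ : PowIdx k (2 * q)) (x : PowSummand X k κ), x ∈ (powSummandHodge exists_isReal_hodgeModel_holds hX k κ).hodgeClasses (q : ℤ) → fanKunnethMap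 π hlim (2 * q) (powInsert X k κ x) ∈ Submodule.span ℚ {x : bettiCohomology Y (2 * q) | ∃ (q' r : ℕ) (u : Fin r → Fin (k + 1)) (wdec : bettiCohomology Y (2 * q')) (_ : ofRatClass (ComplexPoints Y) (2 * q') wdec ∈ algebraicClasses Y q') (E : hodgeTensorSpace (bettiCohomology X 2) r 0 →ₗ[ℚ] bettiCohomology Y (2 * q)) (_ : (∀ w : Fin r → Fin (Module.finrank ℚ (bettiCohomology X 2)), (⟨2 * q, E ((PiTensorProduct.tprod ℚ fun i => (Module.finBasis ℚ (bettiCohomology X 2)) (w i)) ⊗ₜ[ℚ] (PiTensorProduct.tprod ℚ fun i : Fin 0 => (Fin.elim0 i : Module.Dual ℚ (bettiCohomology X 2))))⟩ : Σ n, bettiCohomology Y n) = List.foldl (fun (acc : Σ n, bettiCohomology Y n) (i : Fin r) => ⟨acc.1 + 2, cup Y acc.1 2 acc.2 (pull (π (u i)) 2 ((Module.finBasis ℚ (bettiCohomology X 2)) (w i)))⟩) ⟨2 * q', wdec⟩ (List.finRange r))) (t : hodgeTensorSpace (bettiCohomology X 2) r 0) (_ : (∃ p' : ℤ, ((r : ℤ)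 - ((0 : ℕ) : ℤ)) * ((2 : ℕ) : ℤ) = 2 * p' ∧ t ∈ ((hodge exists_isReal_hodgeModel_holds hX 2).tensorSpace r 0).hodgeClasses p')), x = E t} :=
  summandHodgeNormalForm_of_fulton fulton1998_map_mem_algebraicClasses_holds

end Summit.HodgeConjecture.HodgeConjecture.Theorems.Q8SymplecticPowersSummandHodgeNormalForm

end
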